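import Literature.Analysis.FluidPDE.NewtonPotential
import Literature.Analysis.FluidPDE.HessianLaplacian
import Literature.Analysis.FluidPDE.HelmholtzAnnihilator
import Literature.Analysis.UnboundedOperators.HeatKernel
import HarnessLib

/-!
# The truncated Newton potential: `Δ(Γ₀ ⋆ g) = g − λ ⋆ g` and the `L²` bound on its Hessian

Analysis/FluidPDE support file (first brick of the discharge of Tao 2011, §10, the nonlinear
estimate `NS.tao2011_nonlinearEstimate`, whose proof needs a *local* Biot–Savart law:
"`u = O(Δ⁻¹∇(ψᵢω)) + v` … From Plancherel's theorem we have
`‖∇Δ⁻¹∇(ψᵢω)‖_{L²} ≲ ‖ψᵢω‖_{L²}`", arXiv:1108.1165, p. 32). In the tree the role of `Δ⁻¹` is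
played by the **truncated** Newton kernel `Γ₀ = θΓ` of `NewtonKernel.lean`
(`NS.newtonNear r₀ r₁`, compactly supported in `B̄(0, r₁)`, integrable), for which
`NewtonPotential.lean` proves Green's representation `∫ Γ₀ Δφ = φ(0) − ∫ λ φ`, `λ = Δ((1 − θ)Γ)`
smooth with compact support. This file turns that identity into operator bounds, **without any
Fourier analysis**:

* `convolution_newtonNear_laplacian` — `(Γ₀ ⋆ Δg)(x) = g(x) − (λ ⋆ g)(x)` for `g ∈ C²`;
* `laplacian_convolution_newtonNear` — `Δ(Γ₀ ⋆ g) = Γ₀ ⋆ Δg = g − λ ⋆ g` for `g ∈ C_c²`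
  (derivatives fall on the compactly supported factor; tree `laplacian_convolution_lsmul`);
* `eLpNorm_laplacian_convolution_newtonNear_le` — `‖Δ(Γ₀ ⋆ g)‖₂ ≤ (1 + ‖λ‖₁)‖g‖₂` (Young);
* `eLpNorm_fderiv_fderiv_convolution_newtonNear_le` — **`‖∂ⱼ∂ᵢ(Γ₀ ⋆ g)‖₂ ≤ (1 + ‖λ‖₁)‖g‖₂`** for
  `g ∈ C_c^∞` and coordinate directions, from the Hessian–Laplacian identity
  `Σᵢⱼ∫(∂ⱼ∂ᵢG)² = ∫(ΔG)²` (tree `HessianLaplacian.lean`, Stein 1970 Ch. III §1.3 with `p = 2`);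
* `fderiv_fderiv_convolution_newtonNear_apply` — `∂ⱼ∂ᵢ(Γ₀ ⋆ g) = Γ₀ ⋆ ∂ⱼ∂ᵢg`;
* `lintegral_enorm_newtonFarLaplacian_scale` — `‖λ^{cr₀, cr₁}‖_{L¹} = ‖λ^{r₀, r₁}‖_{L¹}` (the bound
  is scale invariant).

## Mathlib / tree search

Tree: `newtonNear`, `newtonFarLaplacian`, `integral_newtonNear_mul_laplacian`, `newtonNear_scale`,
`newtonFarLaplacian_scale` (`NewtonKernel`, `NewtonPotential`), `laplacian_convolution_lsmul`,
`fderiv_convolution_lsmul_apply` (`HelmholtzAnnihilator`),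
`integral_sum_sq_fderiv_fderiv_eq_integral_laplacian_sq` (`HessianLaplacian`),
`eLpNorm_convolution_le_lintegral_enorm_mul` (`UnboundedOperators/HeatKernel`). Mathlib:
`convolution_flip`, `HasCompactSupport.contDiff_convolution_right`, `HasCompactSupport.convolution`,
`integral_neg_eq_self`, `Measure.map_addHaar_smul` (Haar scaling).

## References

* T. Tao, arXiv:1108.1165 (`Tao2011`), §10, proof of Thm. 10.1 (p. 32, the local Biot–Savart law).
* E. M. Stein, *Singular integrals and differentiability properties of functions* (1970),
  Ch. III §1.3, Prop. 3 (`‖∂ⱼ∂ₖf‖_p ≤ A_p‖Δf‖_p`).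
* D. Gilbarg, N. Trudinger, *Elliptic PDE of second order*, (2.16)–(2.17), Lemma 4.2.
-/

noncomputable section

open MeasureTheory Set Function Filter Metric
open scoped ENNReal NNReal Topology Laplacian Convolution ContDiff

namespace Literature.Analysis.FluidPDE

section TruncatedNewton

variable {r₀ r₁ : ℝ}

/-- `Γ₀` is even (it is radial). [folklore] -/
theorem newtonNear_neg (r₀ r₁ : ℝ) (z : EuclideanSpace ℝ (Fin 3)) :
    newtonNear r₀ r₁ (-z) = newtonNear r₀ r₁ z := by
  rw [newtonNear, newtonNear, radialCutoff_radial r₀ r₁ (norm_neg z), newtonKernel_eq,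
    newtonKernel_eq, norm_neg]

/-- `λ = ΔΓ∞` is even (it is radial). [folklore] -/
theorem newtonFarLaplacian_neg (h₀ : 0 < r₀) (h₁ : r₀ < r₁) (z : EuclideanSpace ℝ (Fin 3)) :
    newtonFarLaplacian r₀ r₁ (-z) = newtonFarLaplacian r₀ r₁ z := by
  rw [newtonFarLaplacian_eq_profile h₀ h₁, newtonFarLaplacian_eq_profile h₀ h₁, norm_neg]

/-- Real convolution (scalar kernel, `lsmul`) is commutative. [folklore] -/
theorem convolution_lsmul_comm (f g : EuclideanSpace ℝ (Fin 3) → ℝ) :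
    (f ⋆[ContinuousLinearMap.lsmul ℝ ℝ, volume] g) = g ⋆[ContinuousLinearMap.lsmul ℝ ℝ, volume] f := by
  have hflip : (ContinuousLinearMap.lsmul ℝ ℝ : ℝ →L[ℝ] ℝ →L[ℝ] ℝ).flip = ContinuousLinearMap.lsmul ℝ ℝ := by
    ext
    simp
  rw [← convolution_flip, hflip]

/-- **Green's representation in convolution form.** For `g ∈ C²(ℝ³)` and `0 < r₀ < r₁`,
`(Γ₀ ⋆ Δg)(x) = g(x) − (λ ⋆ g)(x)` — the tree's `∫ Γ₀ Δφ = φ(0) − ∫ λ φ` applied to the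
translate `φ = g(x + ·)`, with the substitution `z ↦ −z` and the evenness of both kernels.
[cite: Tao2011, §10, proof of Thm. 10.1 (local Biot–Savart law); Gilbarg–Trudinger (2.16)–(2.17)] -/
theorem convolution_newtonNear_laplacian (h₀ : 0 < r₀) (h₁ : r₀ < r₁)
    {g : EuclideanSpace ℝ (Fin 3) → ℝ} (hg : ContDiff ℝ 2 g) (x : EuclideanSpace ℝ (Fin 3)) :
    (newtonNear r₀ r₁ ⋆[ContinuousLinearMap.lsmul ℝ ℝ, volume] (Δ g)) x =
      g x - (newtonFarLaplacian r₀ r₁ ⋆[ContinuousLinearMap.lsmul ℝ ℝ, volume] g) x := by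
  set φ : EuclideanSpace ℝ (Fin 3) → ℝ := fun z => g (x + z) with hφ
  have hφ2 : ContDiff ℝ 2 φ := hg.comp (contDiff_const.add contDiff_id)
  have hGreen := integral_newtonNear_mul_laplacian h₀ h₁ hφ2
  have hΔφ : ∀ z, (Δ φ) z = (Δ g) (x + z) := fun z => laplacian_comp_const_add g x z
  simp only [convolution_def, ContinuousLinearMap.lsmul_apply, smul_eq_mul]
  -- substitute `t ↦ -t` in both convolution integrals
  have e1 : ∫ t, newtonNear r₀ r₁ t * (Δ g) (x - t) = ∫ z, newtonNear r₀ r₁ z * (Δ φ) z := by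
    rw [← integral_neg_eq_self]
    refine integral_congr_ae (Eventually.of_forall fun z => ?_)
    simp only [newtonNear_neg, hΔφ, sub_neg_eq_add]
  have e2 : ∫ t, newtonFarLaplacian r₀ r₁ t * g (x - t) = ∫ z, newtonFarLaplacian r₀ r₁ z * φ z := by
    rw [← integral_neg_eq_self]
    refine integral_congr_ae (Eventually.of_forall fun z => ?_)
    simp only [newtonFarLaplacian_neg h₀ h₁, hφ, sub_neg_eq_add]
  rw [e1, e2, hGreen]
  simp [hφ]

/-- Local integrability of `Γ₀` (it is integrable). [folklore] -/
theorem locallyIntegrable_newtonNear (h₀ : 0 ≤ r₀) (h₁ : r₀ < r₁) :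
    LocallyIntegrable (newtonNear r₀ r₁) (volume : Measure (EuclideanSpace ℝ (Fin 3))) :=
  (integrable_newtonNear h₀ h₁).locallyIntegrable

/-- **Derivatives fall on the compactly supported factor, Laplacian:** for `g ∈ C_c²`,
`Δ(Γ₀ ⋆ g) = Γ₀ ⋆ Δg`. [folklore] -/
theorem laplacian_convolution_newtonNear (h₀ : 0 < r₀) (h₁ : r₀ < r₁)
    {g : EuclideanSpace ℝ (Fin 3) → ℝ} (hg : ContDiff ℝ 2 g) (hgc : HasCompactSupport g)
    (x : EuclideanSpace ℝ (Fin 3)) :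
    (Δ (newtonNear r₀ r₁ ⋆[ContinuousLinearMap.lsmul ℝ ℝ, volume] g)) x =
      (newtonNear r₀ r₁ ⋆[ContinuousLinearMap.lsmul ℝ ℝ, volume] (Δ g)) x := by
  rw [convolution_lsmul_comm (newtonNear r₀ r₁) g, convolution_lsmul_comm (newtonNear r₀ r₁) (Δ g)]
  exact laplacian_convolution_lsmul hg hgc (locallyIntegrable_newtonNear h₀.le h₁) x

/-- **Derivatives fall on the compactly supported factor, second derivatives:** for `g ∈ C_c²`,
`∂ᵥ∂ᵤ(Γ₀ ⋆ g) = Γ₀ ⋆ ∂ᵥ∂ᵤg`. [folklore] -/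
theorem fderiv_fderiv_convolution_newtonNear_apply (h₀ : 0 < r₀) (h₁ : r₀ < r₁)
    {g : EuclideanSpace ℝ (Fin 3) → ℝ} (hg : ContDiff ℝ 2 g) (hgc : HasCompactSupport g)
    (x u v : EuclideanSpace ℝ (Fin 3)) :
    fderiv ℝ (fun y => fderiv ℝ (newtonNear r₀ r₁ ⋆[ContinuousLinearMap.lsmul ℝ ℝ, volume] g) y u) x v =
      (newtonNear r₀ r₁ ⋆[ContinuousLinearMap.lsmul ℝ ℝ, volume]
        (fun y => fderiv ℝ (fun z => fderiv ℝ g z u) y v)) x := by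
  have hloc := locallyIntegrable_newtonNear h₀.le h₁
  have hg1 : ContDiff ℝ 1 g := hg.of_le one_le_two
  have hgu : ContDiff ℝ 1 fun z => fderiv ℝ g z u :=
    (hg.fderiv_right (m := 1) le_rfl).clm_apply contDiff_const
  have hgcu : HasCompactSupport fun z => fderiv ℝ g z u := hgc.fderiv_apply (𝕜 := ℝ) u
  -- first derivative
  have h1 : (fun y => fderiv ℝ (newtonNear r₀ r₁ ⋆[ContinuousLinearMap.lsmul ℝ ℝ, volume] g) y u) =
      (fun z => fderiv ℝ g z u) ⋆[ContinuousLinearMap.lsmul ℝ ℝ, volume] newtonNear r₀ r₁ := by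
    funext y
    rw [convolution_lsmul_comm (newtonNear r₀ r₁) g]
    exact fderiv_convolution_lsmul_apply hg1 hgc hloc y u
  rw [h1, fderiv_convolution_lsmul_apply hgu hgcu hloc x v,
    convolution_lsmul_comm _ (newtonNear r₀ r₁)]

/-- `Γ₀ ⋆ g` is smooth when `g ∈ C_c^∞` (any finite order `n`). [folklore] -/
theorem contDiff_convolution_newtonNear (h₀ : 0 ≤ r₀) (h₁ : r₀ < r₁)
    {g : EuclideanSpace ℝ (Fin 3) → ℝ} {n : ℕ∞} (hg : ContDiff ℝ n g) (hgc : HasCompactSupport g) :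
    ContDiff ℝ n (newtonNear r₀ r₁ ⋆[ContinuousLinearMap.lsmul ℝ ℝ, volume] g) :=
  hgc.contDiff_convolution_right _ (locallyIntegrable_newtonNear h₀ h₁) hg

/-- `Γ₀ ⋆ g` has compact support when `g` has. [folklore] -/
theorem hasCompactSupport_convolution_newtonNear (h₀ : 0 ≤ r₀) (h₁ : r₀ < r₁)
    {g : EuclideanSpace ℝ (Fin 3) → ℝ} (hgc : HasCompactSupport g) :
    HasCompactSupport (newtonNear r₀ r₁ ⋆[ContinuousLinearMap.lsmul ℝ ℝ, volume] g) :=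
  (hasCompactSupport_newtonNear h₀ h₁).convolution _ hgc

/-- **`‖Δ(Γ₀ ⋆ g)‖_{L²} ≤ (1 + ‖λ‖_{L¹}) ‖g‖_{L²}`** for `g ∈ C_c²` (Green + Young). [folklore] -/
theorem eLpNorm_laplacian_convolution_newtonNear_le (h₀ : 0 < r₀) (h₁ : r₀ < r₁)
    {g : EuclideanSpace ℝ (Fin 3) → ℝ} (hg : ContDiff ℝ 2 g) (hgc : HasCompactSupport g) :
    eLpNorm (Δ (newtonNear r₀ r₁ ⋆[ContinuousLinearMap.lsmul ℝ ℝ, volume] g)) 2 volume ≤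
      (1 + ∫⁻ z, ‖newtonFarLaplacian r₀ r₁ z‖ₑ) * eLpNorm g 2 volume := by
  have hfun : (Δ (newtonNear r₀ r₁ ⋆[ContinuousLinearMap.lsmul ℝ ℝ, volume] g)) =
      g - newtonFarLaplacian r₀ r₁ ⋆[ContinuousLinearMap.lsmul ℝ ℝ, volume] g := by
    funext x
    rw [laplacian_convolution_newtonNear h₀ h₁ hg hgc x, convolution_newtonNear_laplacian h₀ h₁ hg x,
      Pi.sub_apply]
  rw [hfun]
  have hgm : AEStronglyMeasurable g volume := hg.continuous.aestronglyMeasurable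
  have hlam : AEStronglyMeasurable (newtonFarLaplacian r₀ r₁) volume :=
    (continuous_newtonFarLaplacian h₀ h₁).aestronglyMeasurable
  have hconvm : AEStronglyMeasurable
      (newtonFarLaplacian r₀ r₁ ⋆[ContinuousLinearMap.lsmul ℝ ℝ, volume] g) volume :=
    ((hasCompactSupport_newtonFarLaplacian h₀.le h₁).contDiff_convolution_left _
      (contDiff_newtonFarLaplacian h₀ h₁ (n := 0)) hg.continuous.locallyIntegrable).continuous.aestronglyMeasurable
  calc eLpNorm (g - newtonFarLaplacian r₀ r₁ ⋆[ContinuousLinearMap.lsmul ℝ ℝ, volume] g) 2 volume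
      ≤ eLpNorm g 2 volume +
          eLpNorm (newtonFarLaplacian r₀ r₁ ⋆[ContinuousLinearMap.lsmul ℝ ℝ, volume] g) 2 volume :=
        eLpNorm_sub_le hgm hconvm one_le_two
    _ ≤ eLpNorm g 2 volume + (∫⁻ z, ‖newtonFarLaplacian r₀ r₁ z‖ₑ) * eLpNorm g 2 volume := by
        gcongr
        exact UnboundedOperators.eLpNorm_convolution_le_lintegral_enorm_mul hlam hgm one_le_two
    _ = (1 + ∫⁻ z, ‖newtonFarLaplacian r₀ r₁ z‖ₑ) * eLpNorm g 2 volume := by ring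

/-! ### The Hessian bound -/

/-- Comparison of `L²` norms of two continuous compactly supported real functions from the
comparison of `∫ f²` and `∫ h²`. [folklore] -/
theorem eLpNorm_two_le_of_integral_sq_le {f h : EuclideanSpace ℝ (Fin 3) → ℝ} (hf : Continuous f)
    (hfc : HasCompactSupport f) (hh : Continuous h) (hhc : HasCompactSupport h)
    (hle : ∫ x, f x ^ 2 ≤ ∫ x, h x ^ 2) : eLpNorm f 2 volume ≤ eLpNorm h 2 volume := by
  have hfi : Integrable (fun x => f x ^ 2) :=
    (hf.pow 2).integrable_of_hasCompactSupport (by rw [show f ^ 2 = f * f from sq f]; exact hfc.mul_right)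
  have hhi : Integrable (fun x => h x ^ 2) :=
    (hh.pow 2).integrable_of_hasCompactSupport (by rw [show h ^ 2 = h * h from sq h]; exact hhc.mul_right)
  have e : ∀ (k : EuclideanSpace ℝ (Fin 3) → ℝ), (∫⁻ x, ‖k x‖ₑ ^ 2) = ∫⁻ x, ENNReal.ofReal (k x ^ 2) := by
    intro k
    refine lintegral_congr fun x => ?_
    rw [Real.enorm_eq_ofReal_abs, ← ENNReal.ofReal_pow (abs_nonneg _), sq_abs]
  -- `‖k‖₂ = (∫⁻ ‖k‖ₑ²)^{1/2}`
  have e2 : ∀ (k : EuclideanSpace ℝ (Fin 3) → ℝ),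
      eLpNorm k 2 volume = (∫⁻ x, ‖k x‖ₑ ^ 2) ^ (1 / 2 : ℝ) := by
    intro k
    rw [eLpNorm_eq_lintegral_rpow_enorm_toReal (by norm_num) (by norm_num)]
    simp only [ENNReal.toReal_ofNat]
    congr 1
    refine lintegral_congr fun x => ?_
    rw [show (2 : ℝ) = (2 : ℕ) by norm_num, ENNReal.rpow_natCast]
  rw [e2, e2, e, e,
    ← ofReal_integral_eq_lintegral_ofReal hfi (Eventually.of_forall fun x => sq_nonneg _),
    ← ofReal_integral_eq_lintegral_ofReal hhi (Eventually.of_forall fun x => sq_nonneg _)]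
  exact ENNReal.rpow_le_rpow (ENNReal.ofReal_le_ofReal hle) (by norm_num)

/-- The Laplacian of the truncated Newton potential of `g ∈ C_c²` has compact support
(`ΔG = g − λ ⋆ g`). [folklore] -/
theorem hasCompactSupport_laplacian_convolution_newtonNear (h₀ : 0 < r₀) (h₁ : r₀ < r₁)
    {g : EuclideanSpace ℝ (Fin 3) → ℝ} (hg : ContDiff ℝ 2 g) (hgc : HasCompactSupport g) :
    HasCompactSupport (Δ (newtonNear r₀ r₁ ⋆[ContinuousLinearMap.lsmul ℝ ℝ, volume] g)) := by
  have hfun : (Δ (newtonNear r₀ r₁ ⋆[ContinuousLinearMap.lsmul ℝ ℝ, volume] g)) =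
      g - newtonFarLaplacian r₀ r₁ ⋆[ContinuousLinearMap.lsmul ℝ ℝ, volume] g := by
    funext x
    rw [laplacian_convolution_newtonNear h₀ h₁ hg hgc x, convolution_newtonNear_laplacian h₀ h₁ hg x,
      Pi.sub_apply]
  rw [hfun]
  exact hgc.sub ((hasCompactSupport_newtonFarLaplacian h₀.le h₁).convolution _ hgc)

/-- **`L²` bound on the Hessian of the truncated Newton potential** (the tree's substitute for
Tao's "From Plancherel's theorem we have `‖∇Δ⁻¹∇(ψᵢω)‖_{L²} ≲ ‖ψᵢω‖_{L²}`", p. 32): for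
`g ∈ C_c^∞(ℝ³)`, `0 < r₀ < r₁` and coordinate directions `eᵢ, eⱼ`,
`‖∂ⱼ∂ᵢ(Γ₀ ⋆ g)‖_{L²} ≤ (1 + ‖λ‖_{L¹}) ‖g‖_{L²}`: each Hessian entry is dominated in `L²` by the
Laplacian (`Σᵢⱼ∫(∂ⱼ∂ᵢG)² = ∫(ΔG)²`, Stein 1970 Ch. III §1.3 with `p = 2`), and
`ΔG = g − λ ⋆ g`. [cite: Tao2011, §10, proof of Thm. 10.1 (local Biot–Savart law, Plancherel step)] -/
theorem eLpNorm_fderiv_fderiv_convolution_newtonNear_le (h₀ : 0 < r₀) (h₁ : r₀ < r₁)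
    {g : EuclideanSpace ℝ (Fin 3) → ℝ} (hg : ContDiff ℝ ∞ g) (hgc : HasCompactSupport g)
    (i j : Fin 3) :
    eLpNorm (fun x => fderiv ℝ (fun y => fderiv ℝ
        (newtonNear r₀ r₁ ⋆[ContinuousLinearMap.lsmul ℝ ℝ, volume] g) y
        (EuclideanSpace.basisFun (Fin 3) ℝ i)) x (EuclideanSpace.basisFun (Fin 3) ℝ j)) 2 volume ≤
      (1 + ∫⁻ z, ‖newtonFarLaplacian r₀ r₁ z‖ₑ) * eLpNorm g 2 volume := by
  set b := EuclideanSpace.basisFun (Fin 3) ℝ with hb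
  set G := newtonNear r₀ r₁ ⋆[ContinuousLinearMap.lsmul ℝ ℝ, volume] g with hGdef
  have hg2 : ContDiff ℝ 2 g := hg.of_le (by norm_cast)
  have hG : ContDiff ℝ ∞ G := contDiff_convolution_newtonNear h₀.le h₁ hg hgc
  have hGc : HasCompactSupport G := hasCompactSupport_convolution_newtonNear h₀.le h₁ hgc
  have hG3 : ContDiff ℝ 3 G := hG.of_le (by norm_cast)
  have hG2 : ContDiff ℝ 2 G := hG.of_le (by norm_cast)
  have hsum := integral_sum_sq_fderiv_fderiv_eq_integral_laplacian_sq b hG3 hGc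
  -- every Hessian entry is dominated by the double sum
  have hnn : ∀ i' j', 0 ≤ ∫ x, (fderiv ℝ (fun y => fderiv ℝ G y (b i')) x (b j')) ^ 2 :=
    fun i' j' => integral_nonneg fun x => sq_nonneg _
  have hle : ∫ x, (fderiv ℝ (fun y => fderiv ℝ G y (b i)) x (b j)) ^ 2 ≤ ∫ x, ((Δ G) x) ^ 2 := by
    rw [← hsum]
    calc ∫ x, (fderiv ℝ (fun y => fderiv ℝ G y (b i)) x (b j)) ^ 2
        ≤ ∑ j', ∫ x, (fderiv ℝ (fun y => fderiv ℝ G y (b i)) x (b j')) ^ 2 :=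
          Finset.single_le_sum (f := fun j' => ∫ x, (fderiv ℝ (fun y => fderiv ℝ G y (b i)) x (b j')) ^ 2)
            (fun j' _ => hnn i j') (Finset.mem_univ j)
      _ ≤ ∑ i', ∑ j', ∫ x, (fderiv ℝ (fun y => fderiv ℝ G y (b i')) x (b j')) ^ 2 :=
          Finset.single_le_sum (f := fun i' => ∑ j', ∫ x, (fderiv ℝ (fun y => fderiv ℝ G y (b i')) x (b j')) ^ 2)
            (fun i' _ => Finset.sum_nonneg fun j' _ => hnn i' j') (Finset.mem_univ i)
  have hcont : Continuous fun x => fderiv ℝ (fun y => fderiv ℝ G y (b i)) x (b j) :=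
    continuous_fderiv_fderiv_apply hG2 (b i) (b j)
  have hcs : HasCompactSupport fun x => fderiv ℝ (fun y => fderiv ℝ G y (b i)) x (b j) :=
    hasCompactSupport_fderiv_fderiv_apply hGc (b i) (b j)
  have hΔc : Continuous (Δ G) := FluidPDE.continuous_laplacian hG2
  have hΔcs : HasCompactSupport (Δ G) := hasCompactSupport_laplacian_convolution_newtonNear h₀ h₁ hg2 hgc
  exact (eLpNorm_two_le_of_integral_sq_le hcont hcs hΔc hΔcs hle).trans
    (eLpNorm_laplacian_convolution_newtonNear_le h₀ h₁ hg2 hgc)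

/-! ### Scale invariance of `‖λ‖_{L¹}` -/

/-- **`‖λ^{cr₀,cr₁}‖_{L¹} = ‖λ^{r₀,r₁}‖_{L¹}`**: `λ^{cr₀,cr₁}(z) = c⁻³λ^{r₀,r₁}(c⁻¹z)` and Lebesgue
measure on `ℝ³` scales by `c³`. [folklore] -/
theorem lintegral_enorm_newtonFarLaplacian_scale {c : ℝ} (hc : 0 < c) (r₀ r₁ : ℝ) :
    ∫⁻ z, ‖newtonFarLaplacian (c * r₀) (c * r₁) z‖ₑ = ∫⁻ z, ‖newtonFarLaplacian r₀ r₁ z‖ₑ := by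
  have h1 : ∀ z : EuclideanSpace ℝ (Fin 3), ‖newtonFarLaplacian (c * r₀) (c * r₁) z‖ₑ =
      ENNReal.ofReal (c⁻¹ ^ 3) * ‖newtonFarLaplacian r₀ r₁ (c⁻¹ • z)‖ₑ := fun z => by
    rw [newtonFarLaplacian_scale hc r₀ r₁ z, enorm_mul, Real.enorm_eq_ofReal (by positivity)]
  simp_rw [h1]
  -- change of variables `z ↦ c⁻¹ z` (Mathlib `Measure.map_addHaar_smul`)
  have hscale : ∫⁻ x, (fun z => ‖newtonFarLaplacian r₀ r₁ z‖ₑ) (c⁻¹ • x) =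
      ENNReal.ofReal ((c⁻¹ ^ 3)⁻¹) * ∫⁻ x, ‖newtonFarLaplacian r₀ r₁ x‖ₑ := by
    have hc0 : c⁻¹ ≠ 0 := inv_ne_zero hc.ne'
    let e : EuclideanSpace ℝ (Fin 3) ≃ᵐ EuclideanSpace ℝ (Fin 3) :=
      (Homeomorph.smul (isUnit_iff_ne_zero.2 hc0).unit).toMeasurableEquiv
    have he : (e : EuclideanSpace ℝ (Fin 3) → EuclideanSpace ℝ (Fin 3)) = fun x => c⁻¹ • x := rfl
    calc ∫⁻ x, (fun z => ‖newtonFarLaplacian r₀ r₁ z‖ₑ) (c⁻¹ • x)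
          = ∫⁻ y, ‖newtonFarLaplacian r₀ r₁ y‖ₑ ∂(Measure.map (fun x => c⁻¹ • x) volume) := by
          rw [← he, lintegral_map_equiv]; rfl
      _ = ENNReal.ofReal ((c⁻¹ ^ 3)⁻¹) * ∫⁻ x, ‖newtonFarLaplacian r₀ r₁ x‖ₑ := by
          rw [Measure.map_addHaar_smul volume hc0, lintegral_smul_measure,
            finrank_euclideanSpace_fin, abs_of_nonneg (by positivity), smul_eq_mul]
  rw [lintegral_const_mul' _ _ ENNReal.ofReal_ne_top]
  erw [hscale]
  rw [← mul_assoc, ← ENNReal.ofReal_mul (by positivity)]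
  have : c⁻¹ ^ 3 * (c⁻¹ ^ 3)⁻¹ = 1 := mul_inv_cancel₀ (by positivity)
  rw [this, ENNReal.ofReal_one, one_mul]


end TruncatedNewton

end Literature.Analysis.FluidPDE

end
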